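import Summits.BirchSwinnertonDyer.Rank1Residual.Additive.KummerLeGreenbergTwistAscent
import Summits.BirchSwinnertonDyer.Rank1Residual.Additive.RamifiedOrdinaryLineUniqueClasses
import Summits.BirchSwinnertonDyer.Rank1Residual.AdditivePotMult.RamifiedOrdinaryLinePotMult
import HarnessLib

/-!
# R-D ON THE (G-ord, e = 2) ROWS: the ramified ordinary line of `E = C • V^{(p*)}` has
# 'Kummer = Greenberg = strict' over `ℚ_∞`, and cc-typer-2's typed δ-input
# `RamifiedLineKummerEqAt W p` HOLDS on X4♯(G-ord) / X3♯(G-ord), `e = 2` — both mod the typed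
# Greenberg Prop. 2.4 ONLY (file F8 of row T-RD-Δ-K; cell `b2b-bsdres`, team n1011; lead R5-47
# (a)/(b); seat n1011-p05 gen 4)

HONEST FRAMING (cell `b2b-bsdres`, run/shared/lean/b2b/bsd-rank1-residual/, verbatim in every
file): the goal of the cell is to DELETE the COMBINATION-SHAPED residual classes of the
Birch–Swinnerton-Dyer formula for ALL analytic-rank `≤ 1` elliptic curves over `ℚ` — "full BSD
formula for every rank `≤ 1` curve in class `C`" assembled STRICTLY from published theorems — so
that the rank-`≤ 1` remainder becomes exactly the CONSTRUCTION-SHAPED classes, which are TYPED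
(missing-input `Prop`s), NOT attempted. This is not "finishing BSD". Team n1011 (X4 ∧ `p = 3`,
§I N10/N11; ROUTE-2 of planner r2, §II.15.3 ARM δ): research route; ASSEMBLY theorems; the ONLY
named fact entering is the typed published `Greenberg1999.imKummer_ge_strictCondition_goodOrdinary`
(cc-typer-2, p262636; record A239) as the hypothesis `hGrK`; the uniqueness of the ramified ordinary
line is cc-typer-2's KERNEL THEOREM (U1 p267231, U2 p268350, adapters U2b p269277 —
`ClassX4Gord.ramifiedLineKummerEqAt_of_exists` etc.), consumed BY NAME; no definition, no named fact
by this seat; X3♯(G-ord) / X4♯(G-ord) stay CONSTRUCTION-SHAPED; nothing booked; no label changes.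

## What (the (G-ord) twin of p07's `AdditivePotMult/PotMultGreenbergKummerIdentification.lean`)

* §1 twist-model level (`W = C • V^{(p*)}`, `V` globally minimal good ordinary at the odd `p`,
  `p* = (−1)^{(p−1)/2} p`, `K = ℚ(√p*)`, `ord_v p* = 1`):
  `exists_isRamifiedOrdinaryLine_localKerOver_le_of_goodOrd_pStar_twist` — UNCONDITIONAL: at
  `v ∋ p`, for every `ℤ_p`-extension `κ`, `∃ L, IsRamifiedOrdinaryLine W p L ∧
  W.localKerOver p (ker κ) ℚ_v ≤ L.greenbergKer (ker κ)` (F7);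
  `exists_isRamifiedOrdinaryLine_kummer_of_goodOrd_pStar_twist` — mod `hGrK`, `κ` cyclotomic:
  `∃ L, IsRamifiedOrdinaryLine W p L ∧ L.greenbergKer (ker κ) = W.localKerOver p (ker κ) ℚ_v ∧
  L.strictKer (ker κ) = W.localKerOver p (ker κ) ℚ_v` (F6 + F7).
* §2 class forms `ClassX4Gord.exists_isRamifiedOrdinaryLine_kummer` (any odd `p`, `p = 3` included)
  and `ClassX3Gord.exists_isRamifiedOrdinaryLine_kummer` (odd `p`), `e_E(p) = 2`.
* cc-typer-2's ∀-`L` binder DISCHARGED mod `hGrK`: `ramifiedLineKummerEqAt_of_goodOrd_pStar_twist`,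
  **`ClassX4Gord.ramifiedLineKummerEqAt (hGrK) (hX) (he)`**, **`ClassX3Gord.ramifiedLineKummerEqAt
  (hGrK) (hp2) (hX) (he)`** — her adapters `…ramifiedLineKummerEqAt_of_exists` (uniqueness of the
  ramified line, U2b) fed with the ∃-forms above: the R-D input `hRDᵢ : RamifiedLineKummerEqAt Wᵢ p`
  of Route G's GV record (`ClassX4Gord/ClassX3Gord.congruentLambdaShift_of_gv_of_torsionIso`) on
  (G-ord, e = 2) rows is thereby reduced to the ONE typed published fact A239 (`hGrK`).

References: [GreenbergLNM1716] §2 pp. 69–75, §5 p. 143; [GreenbergVatsal2000] §2 p. 26;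
[EmertonPollackWeston2006] §3.1; [CoatesLNM1716] p. 31 (62)–(63).
-/

noncomputable section

open scoped Classical

namespace Summit.BirchSwinnertonDyer.Rank1Residual.Additive

open NumberField IsDedekindDomain Field Literature.NumberTheory.GaloisRepresentations
  Literature.NumberTheory.EllipticCurves Literature.NumberTheory.EllipticCurves.GreenbergSelmer
  Literature.NumberTheory.EllipticCurves.Greenberg1999
  Literature.NumberTheory.EllipticCurves.Rank1Residual
  Literature.NumberTheory.EllipticCurves.EmertonPollackWeston2006 WeierstrassCurve
  Summit.BirchSwinnertonDyer.Rank1Residual.X2.GreenbergVatsalReductionDatum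
  Summit.BirchSwinnertonDyer.Rank1Residual.GaloisImage
  Summit.BirchSwinnertonDyer.Rank1Residual.GaloisImage.RamifiedOrdinaryLineTwist
  Summit.BirchSwinnertonDyer.Rank1Residual.AdditivePotMult
  Summit.BirchSwinnertonDyer.Rank1Residual.AdditivePotMult.RamifiedOrdinaryLinePotMult
  Summit.BirchSwinnertonDyer.Rank1Residual.Additive.TameDescent

/-! ## §1 Twist-model level -/

section Model

variable (p : ℕ) [hp : Fact p.Prime] {W : WeierstrassCurve ℚ}

/-- **UNCONDITIONAL half on a `p*`-twist model of a good-ordinary curve**: `p` odd, `V` globally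
minimal with `GoodOrd V p`, `W = C • V^{(p*)}`, `v ∋ p`, ANY `ℤ_p`-extension `κ`:
`∃ L, IsRamifiedOrdinaryLine W p L ∧ W.localKerOver p (ker κ) ℚ_v ≤ L.greenbergKer (ker κ)` — the
line is the twisted Greenberg datum along additive-p1's geometric transport over `K = ℚ(√p*)`
(F7 `isRamifiedOrdinaryLine_twistMap_geomTransport`, `localKerOver_le_greenbergKer_twistMap_geomTransport`).
[cite: GreenbergLNM1716, §2 pp. 69–75 and §5 p. 143] [cite: EmertonPollackWeston2006, §3.1 (arXiv:math/0404484 p. 17)] -/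
theorem exists_isRamifiedOrdinaryLine_localKerOver_le_of_goodOrd_pStar_twist (hp2 : p ≠ 2)
    (V : WeierstrassCurve ℚ) [V.IsElliptic] [V.IsGloballyMinimal]
    (hCW : ∃ C : VariableChange ℚ, C • V.quadraticTwist ((-1 : ℚ) ^ (p / 2) * p) = W)
    (hV : GoodOrd V p) (κ : ZpExtension ℚ p) {v : HeightOneSpectrum (𝓞 ℚ)}
    (hpv : ((p : ℕ) : 𝓞 ℚ) ∈ v.asIdeal) :
    ∃ L : LocalDatum ℚ (W.geomPrimaryTorsion p) v, IsRamifiedOrdinaryLine W p L ∧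
      W.localKerOver p κ.kerSubgroup (v.adicCompletion ℚ) ≤ L.greenbergKer κ.kerSubgroup := by
  obtain ⟨K, _, _, h2, θ, hθ, hc⟩ := exists_numberField_sq_eq_pStar (p := p) hp2
  obtain ⟨C, hC⟩ := hCW
  have hΔ := V.not_dvd_minimalDiscriminantInt_of_hasGoodReductionAtPrime' p hV.1
  exact ⟨_, isRamifiedOrdinaryLine_twistMap_geomTransport V K h2 hθ hc p hC hp2 hΔ hV.2 hpv
      (valuation_pStar p v hpv),
    localKerOver_le_greenbergKer_twistMap_geomTransport V K h2 hθ hc p hC κ hp2 hΔ hpv⟩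

/-- **R-D on a `p*`-twist model of a good-ordinary curve, mod `hGrK`**: `p` odd, `V` globally
minimal with `GoodOrd V p`, `W = C • V^{(p*)}`, `κ` cyclotomic, `v ∋ p`:
`∃ L, IsRamifiedOrdinaryLine W p L ∧ L.greenbergKer (ker κ) = W.localKerOver p (ker κ) ℚ_v ∧
L.strictKer (ker κ) = W.localKerOver p (ker κ) ℚ_v` — Kummer = Greenberg = strict over `ℚ_∞` for the
twisted Greenberg line (F6 '≤' mod `hGrK`, F7 '≥' and 'Greenberg = strict').
[cite: GreenbergLNM1716, §2 Props. 2.2, 2.4 (pp. 73–75), §5 p. 143] [cite: GreenbergVatsal2000, §2 p. 26] -/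
theorem exists_isRamifiedOrdinaryLine_kummer_of_goodOrd_pStar_twist
    (hGrK : imKummer_ge_strictCondition_goodOrdinary) (hp2 : p ≠ 2)
    (V : WeierstrassCurve ℚ) [V.IsElliptic] [V.IsGloballyMinimal]
    (hCW : ∃ C : VariableChange ℚ, C • V.quadraticTwist ((-1 : ℚ) ^ (p / 2) * p) = W)
    (hV : GoodOrd V p) (κ : ZpExtension ℚ p) (hκ : κ.IsCyclotomic) {v : HeightOneSpectrum (𝓞 ℚ)}
    (hpv : ((p : ℕ) : 𝓞 ℚ) ∈ v.asIdeal) :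
    ∃ L : LocalDatum ℚ (W.geomPrimaryTorsion p) v, IsRamifiedOrdinaryLine W p L ∧
      L.greenbergKer κ.kerSubgroup = W.localKerOver p κ.kerSubgroup (v.adicCompletion ℚ) ∧
      L.strictKer κ.kerSubgroup = W.localKerOver p κ.kerSubgroup (v.adicCompletion ℚ) := by
  obtain ⟨K, _, _, h2, θ, hθ, hc⟩ := exists_numberField_sq_eq_pStar (p := p) hp2
  obtain ⟨C, hC⟩ := hCW
  have hΔ := V.not_dvd_minimalDiscriminantInt_of_hasGoodReductionAtPrime' p hV.1
  exact ⟨_, isRamifiedOrdinaryLine_twistMap_geomTransport V K h2 hθ hc p hC hp2 hΔ hV.2 hpv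
      (valuation_pStar p v hpv),
    greenbergKer_twistMap_geomTransport_eq_localKerOver V K h2 hθ hc p hC κ hGrK hp2 hΔ hV.2 hκ hpv
      (valuation_pStar p v hpv),
    strictKer_twistMap_geomTransport_eq_localKerOver V K h2 hθ hc p hC κ hGrK hp2 hΔ hV.2 hκ hpv
      (valuation_pStar p v hpv)⟩

/-- **cc-typer-2's ∀-`L` binder on a `p*`-twist model, mod `hGrK` ONLY**: `p` odd, `V` globally
minimal with `GoodOrd V p`, `W = C • V^{(p*)}` (`W` elliptic, globally minimal) ⟹
`RamifiedLineKummerEqAt W p` — her adapter `ramifiedLineKummerEqAt_of_exists_of_goodOrd_pStar_twist`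
(uniqueness of the ramified ordinary line, U2/U2b) fed with
`exists_isRamifiedOrdinaryLine_kummer_of_goodOrd_pStar_twist` (F6 + F7).
[cite: GreenbergLNM1716, §2 Props. 2.2, 2.4 (pp. 73–75), §5 p. 143] [cite: GreenbergVatsal2000, §2 p. 26]
[cite: CoatesLNM1716, p. 31 (62)–(63)] -/
theorem ramifiedLineKummerEqAt_of_goodOrd_pStar_twist [W.IsElliptic] [W.IsGloballyMinimal]
    (hGrK : imKummer_ge_strictCondition_goodOrdinary) (hp2 : p ≠ 2)
    (V : WeierstrassCurve ℚ) [V.IsElliptic] [V.IsGloballyMinimal]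
    (hCW : ∃ C : VariableChange ℚ, C • V.quadraticTwist ((-1 : ℚ) ^ (p / 2) * p) = W)
    (hV : GoodOrd V p) : RamifiedLineKummerEqAt W p :=
  ramifiedLineKummerEqAt_of_exists_of_goodOrd_pStar_twist V hCW hV fun κ hκ _ hv ↦ by
    obtain ⟨L, hL, hGr, -⟩ :=
      exists_isRamifiedOrdinaryLine_kummer_of_goodOrd_pStar_twist p hGrK hp2 V hCW hV κ hκ hv
    exact ⟨L, hL, hGr⟩

end Model

/-! ## §2 Class forms: X4♯(G-ord) ∩ `I₀*` (any odd `p`, `p = 3` included) and X3♯(G-ord) ∩ `I₀*` -/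

section Classes

variable {p : ℕ} [hp : Fact p.Prime] {W : WeierstrassCurve ℚ} [W.IsElliptic] [W.IsGloballyMinimal]

/-- **X4♯(G-ord), `e_E(p) = 2`: R-D over `ℚ_∞` for a ramified ordinary line, mod `hGrK`** —
`∃ L, IsRamifiedOrdinaryLine W p L ∧ L.greenbergKer (ker κ) = W.localKerOver p (ker κ) ℚ_v ∧
L.strictKer (ker κ) = …` at the place `v ∋ p`, `κ` cyclotomic (good-ordinary `p*`-twist model
`ClassX4Gord.exists_goodOrd_pStar_twist_model` + §1). X4♯(G-ord) stays CONSTRUCTION-SHAPED; nothing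
booked. [cite: GreenbergLNM1716, §2 Props. 2.2, 2.4 (pp. 73–75), §5 p. 143] [cite: GreenbergVatsal2000, §2 p. 26] -/
theorem ClassX4Gord.exists_isRamifiedOrdinaryLine_kummer
    (hGrK : imKummer_ge_strictCondition_goodOrdinary) (hX : ClassX4Gord W p)
    (he : semistabilityIndex W p = 2) (κ : ZpExtension ℚ p) (hκ : κ.IsCyclotomic)
    {v : HeightOneSpectrum (𝓞 ℚ)} (hpv : ((p : ℕ) : 𝓞 ℚ) ∈ v.asIdeal) :
    ∃ L : LocalDatum ℚ (W.geomPrimaryTorsion p) v, IsRamifiedOrdinaryLine W p L ∧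
      L.greenbergKer κ.kerSubgroup = W.localKerOver p κ.kerSubgroup (v.adicCompletion ℚ) ∧
      L.strictKer κ.kerSubgroup = W.localKerOver p κ.kerSubgroup (v.adicCompletion ℚ) := by
  obtain ⟨V, _, _, C, hord, hC⟩ := ClassX4Gord.exists_goodOrd_pStar_twist_model W p hX he
  exact exists_isRamifiedOrdinaryLine_kummer_of_goodOrd_pStar_twist p hGrK hX.addv.1 V ⟨C, hC⟩ hord
    κ hκ hpv

/-- **X4♯(G-ord), `e_E(p) = 2`: the UNCONDITIONAL half** — `∃ L, IsRamifiedOrdinaryLine W p L ∧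
W.localKerOver p (ker κ) ℚ_v ≤ L.greenbergKer (ker κ)` (any `ℤ_p`-extension `κ`).
[cite: GreenbergLNM1716, §2 pp. 69–75 and §5 p. 143] -/
theorem ClassX4Gord.exists_isRamifiedOrdinaryLine_localKerOver_le (hX : ClassX4Gord W p)
    (he : semistabilityIndex W p = 2) (κ : ZpExtension ℚ p)
    {v : HeightOneSpectrum (𝓞 ℚ)} (hpv : ((p : ℕ) : 𝓞 ℚ) ∈ v.asIdeal) :
    ∃ L : LocalDatum ℚ (W.geomPrimaryTorsion p) v, IsRamifiedOrdinaryLine W p L ∧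
      W.localKerOver p κ.kerSubgroup (v.adicCompletion ℚ) ≤ L.greenbergKer κ.kerSubgroup := by
  obtain ⟨V, _, _, C, hord, hC⟩ := ClassX4Gord.exists_goodOrd_pStar_twist_model W p hX he
  exact exists_isRamifiedOrdinaryLine_localKerOver_le_of_goodOrd_pStar_twist p hX.addv.1 V ⟨C, hC⟩
    hord κ hpv

/-- **X4♯(G-ord), `e_E(p) = 2` (any odd `p`, `p = 3` included): cc-typer-2's typed δ-input
`RamifiedLineKummerEqAt W p` HOLDS mod `hGrK` ONLY** — her adapter
`ClassX4Gord.ramifiedLineKummerEqAt_of_exists` (the ramified ordinary line is unique, U2b) fed with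
`ClassX4Gord.exists_isRamifiedOrdinaryLine_kummer`. X4♯(G-ord) stays CONSTRUCTION-SHAPED; nothing
booked. [cite: GreenbergLNM1716, §2 Props. 2.2, 2.4 (pp. 73–75), §5 p. 143]
[cite: GreenbergVatsal2000, §2 p. 26] [cite: CoatesLNM1716, p. 31 (62)–(63)] -/
theorem ClassX4Gord.ramifiedLineKummerEqAt (hGrK : imKummer_ge_strictCondition_goodOrdinary)
    (hX : ClassX4Gord W p) (he : semistabilityIndex W p = 2) : RamifiedLineKummerEqAt W p :=
  hX.ramifiedLineKummerEqAt_of_exists he fun κ hκ _ hv ↦ by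
    obtain ⟨L, hL, hGr, -⟩ := hX.exists_isRamifiedOrdinaryLine_kummer hGrK he κ hκ hv
    exact ⟨L, hL, hGr⟩

/-- **X3♯(G-ord), `e_E(p) = 2`, `p` odd: R-D over `ℚ_∞` for a ramified ordinary line, mod `hGrK`.**
X3♯(G-ord) stays as labelled; nothing booked. [cite: GreenbergLNM1716, §2 Props. 2.2, 2.4 (pp. 73–75), §5 p. 143]
[cite: GreenbergVatsal2000, §2 p. 26] -/
theorem ClassX3Gord.exists_isRamifiedOrdinaryLine_kummer
    (hGrK : imKummer_ge_strictCondition_goodOrdinary) (hp2 : p ≠ 2) (hX : ClassX3Gord W p)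
    (he : semistabilityIndex W p = 2) (κ : ZpExtension ℚ p) (hκ : κ.IsCyclotomic)
    {v : HeightOneSpectrum (𝓞 ℚ)} (hpv : ((p : ℕ) : 𝓞 ℚ) ∈ v.asIdeal) :
    ∃ L : LocalDatum ℚ (W.geomPrimaryTorsion p) v, IsRamifiedOrdinaryLine W p L ∧
      L.greenbergKer κ.kerSubgroup = W.localKerOver p κ.kerSubgroup (v.adicCompletion ℚ) ∧
      L.strictKer κ.kerSubgroup = W.localKerOver p κ.kerSubgroup (v.adicCompletion ℚ) := by
  obtain ⟨V, _, _, C, hord, hC⟩ := ClassX3Gord.exists_goodOrd_pStar_twist_model W p hp2 hX he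
  exact exists_isRamifiedOrdinaryLine_kummer_of_goodOrd_pStar_twist p hGrK hp2 V ⟨C, hC⟩ hord κ hκ hpv

/-- **X3♯(G-ord), `e_E(p) = 2`, `p` odd: the UNCONDITIONAL half.**
[cite: GreenbergLNM1716, §2 pp. 69–75 and §5 p. 143] -/
theorem ClassX3Gord.exists_isRamifiedOrdinaryLine_localKerOver_le (hp2 : p ≠ 2)
    (hX : ClassX3Gord W p) (he : semistabilityIndex W p = 2) (κ : ZpExtension ℚ p)
    {v : HeightOneSpectrum (𝓞 ℚ)} (hpv : ((p : ℕ) : 𝓞 ℚ) ∈ v.asIdeal) :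
    ∃ L : LocalDatum ℚ (W.geomPrimaryTorsion p) v, IsRamifiedOrdinaryLine W p L ∧
      W.localKerOver p κ.kerSubgroup (v.adicCompletion ℚ) ≤ L.greenbergKer κ.kerSubgroup := by
  obtain ⟨V, _, _, C, hord, hC⟩ := ClassX3Gord.exists_goodOrd_pStar_twist_model W p hp2 hX he
  exact exists_isRamifiedOrdinaryLine_localKerOver_le_of_goodOrd_pStar_twist p hp2 V ⟨C, hC⟩ hord κ hpv

/-- **X3♯(G-ord), `e_E(p) = 2`, `p` odd: cc-typer-2's typed δ-input `RamifiedLineKummerEqAt W p`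
HOLDS mod `hGrK` ONLY** (`ClassX3Gord.ramifiedLineKummerEqAt_of_exists` + `ClassX3Gord.exists_isRamifiedOrdinaryLine_kummer`).
X3♯(G-ord) stays as labelled; nothing booked. [cite: GreenbergLNM1716, §2 Props. 2.2, 2.4 (pp. 73–75), §5 p. 143]
[cite: GreenbergVatsal2000, §2 p. 26] [cite: CoatesLNM1716, p. 31 (62)–(63)] -/
theorem ClassX3Gord.ramifiedLineKummerEqAt (hGrK : imKummer_ge_strictCondition_goodOrdinary)
    (hp2 : p ≠ 2) (hX : ClassX3Gord W p) (he : semistabilityIndex W p = 2) :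
    RamifiedLineKummerEqAt W p :=
  hX.ramifiedLineKummerEqAt_of_exists hp2 he fun κ hκ _ hv ↦ by
    obtain ⟨L, hL, hGr, -⟩ := hX.exists_isRamifiedOrdinaryLine_kummer hGrK hp2 he κ hκ hv
    exact ⟨L, hL, hGr⟩

end Classes

end Summit.BirchSwinnertonDyer.Rank1Residual.Additive

end
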